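import Literature.AnabelianGeometry.EtaleTheta.Discharge.Sec5Rho219PinLaws

/-!
# [EtTh] Lemma 5.9 (v) ⟹ Prop. 5.5 at `B_N`: the §2-pinned isomorphism `ρ219` IS Kummer-determined (proof-only)

Mochizuki, *The étale theta function and its Frobenioid-theoretic manifestations*, Publ. RIMS **45** (2009),
Prop. 5.5 p.327 (PDF p.101) («the second Kummer class of Proposition 5.2, (iii), determines an isomorphism
`(l·Δ_Θ)_S ⊗ ℤ/Nℤ ⥲ μ_N(S)`»), Lemma 5.9 (iv)/(v) p.332 (PDF p.106) [cite: MochizukiEtTh2009, Prop 5.5 p.327 (PDF p.101)].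
abc-iut cell, layer L2, seat abc-iut-w4-d042 (gen 2); PROOF-ONLY (0 definitions, 0 named facts), sequel of
`Sec5Rho219Pin.lean` (p419122: the pinned slot `rho219OfBiTheta ψ = ψ ≫ m⁻¹`, `m : μ_N(B_N) ⥲ μ_N` the cyclotome part of
the bi-theta isomorphism) and `Sec5Rho219PinLaws.lean` (p420275/p420661).

CONTENT.  abc-iut-L2-t4's Prop. 5.5 predicate `IsKummerDetermined P ρ hB` says: on `H_{B_N} ∩ (theta pre-subgroup)`,
`ρ_{B_N}[proj h] = s^⊓-gp_N(h) · s^⊔-gp_N(h)⁻¹` (PRINT's orientation, Prop. 4.3 (iii)).  `Sec5Rho219Pin` proved the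
UNIQUENESS direction of Lemma 5.9 (v) (a Kummer-determined `ρ_{B_N}` equals the pinned `ρ219`).  Here, the EXISTENCE
direction: **the pinned §2 isomorphism `ρ219 := rho219OfBiTheta ψ` ITSELF has the Kummer shape** —
* `rho219OfBiTheta_kummerShape_apply` — for `y ∈ Π^tp_Ÿ̲` over `Δ` with `ρ y` in the pre-subgroup, under the `Δ`-leg law
  `IsDeltaLeg` (`ψ[proj(ρ y)] = η(ι y)`): `ρ219[proj(ρ y)] = s^⊓-gp_N(ρ y) · s^⊔-gp_N(ρ y)⁻¹` — both map under
  `μ_N(B_N) ↪ E^Π_N ⥲ Π^tp_Y[μ_N]` to `μ(η(ι y))` (`biThetaIso_muIncl_rho219OfBiTheta`, `biThetaIso_sCapPi_mul_sCupPi_inv`);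
* `rho219OfBiTheta_kummerShape` — hence, given the row-2 laws (hlift, hP) of the real theta subquotient datum
  (GAP G-w5d123-2; `isDeltaLeg_of_rowTwo`), the Kummer shape holds on ALL of `H_{B_N} ∩ (pre-subgroup)`: the body of
  `IsKummerDetermined` for `ρ219`;
* `isKummerDetermined_of_eq_rho219OfBiTheta` — so ANY rigidity family whose `B_N`-component is `ρ219` is
  Kummer-determined (L2-t4's predicate verbatim), and conversely (`Sec5Rho219Pin.cycRigidityCoincide_rho219OfBiTheta`)
  a Kummer-determined family has `B_N`-component `ρ219`: **at `B_N`, «Kummer-determined» ⟺ «equal to the §2-pinned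
  isomorphism»** (`isKummerDetermined_iff_cycRigidityCoincide`), given Lemma 5.9 (iv)'s isomorphism and the row-2 laws.
HONEST FRAMING: inputs = the bi-theta isomorphism `i` over `ι` (L2-t4's `EnvIsoBiTheta` data, discharged by L2-t11 modulo
its dictionary hypotheses) + MERGE-PLAN row 2 (hpre/hlift/hP); this is the `B_N`-component only (the family over all
theta-saturated `S` and its transport-independence, P55-L06, are untouched); [EtTh] refereed; no side taken on
[IUTchIII] Cor. 3.12; typed ≠ proved.
-/

noncomputable section

namespace Literature.AnabelianGeometry.EtaleTheta

open CategoryTheory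
open FrobenioidCyclotomicRigidity

universe w v v' u u'

namespace ThetaFrobenioid

variable {C : Type u} [Category.{v} C] {D : Type u'} [Category.{v'} D] (𝔉 : ThetaFrobenioid.{w} C D)
  (h1 : 𝔉.SectionsFactor) (h3 : 𝔉.OuterActionLZ) (hsec : 𝔉.SgpCapSection) (hcs : 𝔉.SgpCupSection)
  (h8 : 𝔉.ConstantsEqNormalizer) (DK : Set (TopOut 𝔉.EPiN))
  (T : ThetaEnvData.{v} 𝔉.N) (ι : 𝔉.PiX ≃ₜ* T.PiX)
  {η : T.PiYdd → T.mu} (hη : η ∈ T.thetaCocycles)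
  (i : (𝔉.frdBiThetaEnv h1 h3 hsec hcs h8 DK).Iso (T.modelBi hη))

/-- `μ_N(B_N) ↪ E^Π_N`, `u ↦ (u, 1)`, is injective (first component). [cite: MochizukiEtTh2009, Lem 5.9 (iv) p.332 (PDF p.106)] -/
theorem muIncl_inj {u u' : 𝔉.muTorsion 𝔉.BN 𝔉.N} (h : 𝔉.muIncl u = 𝔉.muIncl u') : u = u' := by
  have h' := congrArg (fun e : 𝔉.EPiN => ((e : 𝔉.EPiN) : Aut 𝔉.BN × 𝔉.PiX).1) h
  simp only [coe_muIncl] at h'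
  exact Subtype.ext h'

/-- **The pinned §2 isomorphism has the Kummer shape, pointwise over `Δ`.**  For `y ∈ Π^tp_Ÿ̲` over `Δ` with `ρ y` in the
theta pre-subgroup, under the `Δ`-leg law: `ρ219[proj(ρ y)] = s^⊓-gp_N(ρ y) · s^⊔-gp_N(ρ y)⁻¹` in `μ_N(B_N) ⊆ Aut_C(B_N)`
— since `i(ρ219[proj(ρ y)], 1) = μ(ψ[proj(ρ y)]) = μ(η(ι y)) = i(s^⊓-Π_N(y) · s^⊔-Π_N(y)⁻¹)` and
`s^⊓-Π_N(y) · s^⊔-Π_N(y)⁻¹ = (s^⊓-gp_N(ρ y) · s^⊔-gp_N(ρ y)⁻¹, 1)`. [cite: MochizukiEtTh2009, Prop 5.5 p.327 (PDF p.101); Lem 5.9 (v) p.332 (PDF p.106)] -/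
theorem rho219OfBiTheta_kummerShape_apply
    (hi : ∀ x : 𝔉.EPiN, ((CycEnvelope.proj T.augY T.chi (i.e x) : T.PiY) : T.PiX) = ι (𝔉.toPiY x))
    (hYdd : 𝔉.PiYdd.map ι.toMonoidHom = T.PiYdd) (P : ThetaSubquotientProj 𝔉) (ψ : 𝔉.lDeltaModN 𝔉.BN ≃* T.mu)
    (hψ : 𝔉.IsDeltaLeg T ι η hYdd P ψ) (y : 𝔉.PiYdd) (hy : T.aug (ι (y : 𝔉.PiX)) = 1)
    (hh : ((𝔉.rhoYdd y : 𝔉.HB) : Aut (𝔉.base.obj 𝔉.BN)) ∈ P.pre (𝔉.base.obj 𝔉.BN)) :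
    ((𝔉.rho219OfBiTheta h1 h3 hsec hcs h8 DK T ι hη i hi ψ (QuotientGroup.mk (P.proj _ ⟨_, hh⟩)) :
        𝔉.muTorsion 𝔉.BN 𝔉.N) : Aut 𝔉.BN) =
      𝔉.sgpCap (𝔉.ρ (y : 𝔉.PiX)) * (𝔉.sgpCup (𝔉.rhoYdd y))⁻¹ := by
  obtain ⟨u, hu⟩ := 𝔉.sCapPi_mul_sCupPi_inv_mem_range_muIncl h1 hsec hcs y
  have hufst : (u : Aut 𝔉.BN) = 𝔉.sgpCap (𝔉.ρ (y : 𝔉.PiX)) * (𝔉.sgpCup (𝔉.rhoYdd y))⁻¹ := by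
    have h := congrArg (fun e : 𝔉.EPiN => ((e : 𝔉.EPiN) : Aut 𝔉.BN × 𝔉.PiX).1) hu
    simp only [coe_muIncl, coe_sCapPi_mul_sCupPi_inv_fst] at h
    exact h
  have hiu : i.e (𝔉.muIncl u) = CycEnvelope.inMu T.augY T.chi (η ⟨ι (y : 𝔉.PiX), 𝔉.iota_mem_PiYdd T ι hYdd y⟩) := by
    rw [hu]
    exact 𝔉.biThetaIso_sCapPi_mul_sCupPi_inv h1 h3 hsec hcs h8 DK T ι hη i hi hYdd y hy
  have hiν := 𝔉.biThetaIso_muIncl_rho219OfBiTheta h1 h3 hsec hcs h8 DK T ι hη i hi ψ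
    (QuotientGroup.mk (P.proj _ ⟨_, hh⟩))
  rw [hψ y hy hh, ← hiu] at hiν
  have heq : 𝔉.rho219OfBiTheta h1 h3 hsec hcs h8 DK T ι hη i hi ψ (QuotientGroup.mk (P.proj _ ⟨_, hh⟩)) = u :=
    𝔉.muIncl_inj (i.e.injective hiν)
  rw [heq, hufst]

/-- **Prop. 5.5 at `B_N` for the §2-pinned isomorphism, from the row-2 laws**: given (hlift) and (hP) (GAP G-w5d123-2)
and the bi-theta isomorphism, `ρ219 := rho219OfBiTheta ψ` satisfies the body of L2-t4's `IsKummerDetermined`: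
`∀ h ∈ H_{B_N} ∩ pre, ρ219[proj h] = s^⊓-gp_N(h) · s^⊔-gp_N(h)⁻¹`. [cite: MochizukiEtTh2009, Prop 5.5 p.327 (PDF p.101)] -/
theorem rho219OfBiTheta_kummerShape {l : ℕ} (R : RigidData.{v} 𝔉.N l) (ι : 𝔉.PiX ≃ₜ* R.PiX)
    {η : R.PiYdd → R.mu} (hη : η ∈ R.thetaCocycles)
    (i : (𝔉.frdBiThetaEnv h1 h3 hsec hcs h8 DK).Iso (R.toThetaEnvData.modelBi hη))
    (hi : ∀ x : 𝔉.EPiN, ((CycEnvelope.proj R.augY R.chi (i.e x) : R.PiY) : R.PiX) = ι (𝔉.toPiY x))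
    (hYdd : 𝔉.PiYdd.map ι.toMonoidHom = R.PiYdd) (P : ThetaSubquotientProj 𝔉) (ψ : 𝔉.lDeltaModN 𝔉.BN ≃* R.mu)
    (hlift : ∀ a ∈ 𝔉.HB, a ∈ P.pre (𝔉.base.obj 𝔉.BN) →
      ∃ k : 𝔉.PiYdd, ι (k : 𝔉.PiX) ∈ R.lDeltaTheta ∧ 𝔉.ρ (k : 𝔉.PiX) = a)
    (hP : ∀ (k : 𝔉.PiYdd) (hk : ι (k : 𝔉.PiX) ∈ R.lDeltaTheta) (hm : 𝔉.ρ (k : 𝔉.PiX) ∈ P.pre (𝔉.base.obj 𝔉.BN)),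
      (QuotientGroup.mk (P.proj _ ⟨𝔉.ρ (k : 𝔉.PiX), hm⟩) : 𝔉.lDeltaModN 𝔉.BN) =
        ψ.symm (R.thetaMod ⟨ι (k : 𝔉.PiX), hk⟩))
    (h : 𝔉.HB) (hh : (h : Aut (𝔉.base.obj 𝔉.BN)) ∈ P.pre (𝔉.base.obj 𝔉.BN)) :
    ((𝔉.rho219OfBiTheta h1 h3 hsec hcs h8 DK R.toThetaEnvData ι hη i hi ψ (QuotientGroup.mk (P.proj _ ⟨h, hh⟩)) :
        𝔉.muTorsion 𝔉.BN 𝔉.N) : Aut 𝔉.BN) =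
      𝔉.sgpCap (h : Aut (𝔉.base.obj 𝔉.BN)) * (𝔉.sgpCup h)⁻¹ := by
  obtain ⟨k, hk, hρ⟩ := hlift _ h.2 hh
  have hkh : 𝔉.rhoYdd k = h := Subtype.ext hρ
  subst hkh
  exact 𝔉.rho219OfBiTheta_kummerShape_apply h1 h3 hsec hcs h8 DK R.toThetaEnvData ι hη i hi hYdd P ψ
    (𝔉.isDeltaLeg_of_rowTwo h1 h3 hsec hcs h8 DK R ι hη i hi hYdd P ψ hlift hP) k
    (Subgroup.mem_inf.mp (R.lDeltaTheta_le hk)).2 hh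

/-- **L2-t4's `IsKummerDetermined` for any rigidity family with `B_N`-component `ρ219`** (the EXISTENCE direction of
Prop. 5.5 at `B_N`, supplied by the §2 isomorphism through Lemma 5.9 (iv)). [cite: MochizukiEtTh2009, Prop 5.5 p.327 (PDF p.101)] -/
theorem isKummerDetermined_of_eq_rho219OfBiTheta {l : ℕ} (R : RigidData.{v} 𝔉.N l) (ι : 𝔉.PiX ≃ₜ* R.PiX)
    {η : R.PiYdd → R.mu} (hη : η ∈ R.thetaCocycles)
    (i : (𝔉.frdBiThetaEnv h1 h3 hsec hcs h8 DK).Iso (R.toThetaEnvData.modelBi hη))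
    (hi : ∀ x : 𝔉.EPiN, ((CycEnvelope.proj R.augY R.chi (i.e x) : R.PiY) : R.PiX) = ι (𝔉.toPiY x))
    (hYdd : 𝔉.PiYdd.map ι.toMonoidHom = R.PiYdd) (P : ThetaSubquotientProj 𝔉) (ψ : 𝔉.lDeltaModN 𝔉.BN ≃* R.mu)
    (hlift : ∀ a ∈ 𝔉.HB, a ∈ P.pre (𝔉.base.obj 𝔉.BN) →
      ∃ k : 𝔉.PiYdd, ι (k : 𝔉.PiX) ∈ R.lDeltaTheta ∧ 𝔉.ρ (k : 𝔉.PiX) = a)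
    (hP : ∀ (k : 𝔉.PiYdd) (hk : ι (k : 𝔉.PiX) ∈ R.lDeltaTheta) (hm : 𝔉.ρ (k : 𝔉.PiX) ∈ P.pre (𝔉.base.obj 𝔉.BN)),
      (QuotientGroup.mk (P.proj _ ⟨𝔉.ρ (k : 𝔉.PiX), hm⟩) : 𝔉.lDeltaModN 𝔉.BN) =
        ψ.symm (R.thetaMod ⟨ι (k : 𝔉.PiX), hk⟩))
    (ρf : RigidityFamily 𝔉) (hB : 𝔉.IsThetaSaturated 𝔉.BN)
    (hρf : 𝔉.CycRigidityCoincide (𝔉.rho219OfBiTheta h1 h3 hsec hcs h8 DK R.toThetaEnvData ι hη i hi ψ) ρf hB) :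
    IsKummerDetermined 𝔉 P ρf hB := by
  intro h hh
  have happ : ρf 𝔉.BN hB (QuotientGroup.mk (P.proj _ ⟨h, hh⟩)) =
      𝔉.rho219OfBiTheta h1 h3 hsec hcs h8 DK R.toThetaEnvData ι hη i hi ψ (QuotientGroup.mk (P.proj _ ⟨h, hh⟩)) := by
    rw [hρf]
  rw [happ]
  exact 𝔉.rho219OfBiTheta_kummerShape h1 h3 hsec hcs h8 DK R ι hη i hi hYdd P ψ hlift hP h hh

/-- **At `B_N`: «Kummer-determined» ⟺ «equal to the §2-pinned isomorphism»** (Prop. 5.5's characterization ⟺ Lemma 5.9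
(v)'s coincidence), given the bi-theta isomorphism of (iv) and the row-2 laws (hpre, hlift, hP).
[cite: MochizukiEtTh2009, Prop 5.5 p.327 (PDF p.101); Lem 5.9 (v) p.332 (PDF p.106)] -/
theorem isKummerDetermined_iff_cycRigidityCoincide {l : ℕ} (R : RigidData.{v} 𝔉.N l) (ι : 𝔉.PiX ≃ₜ* R.PiX)
    {η : R.PiYdd → R.mu} (hη : η ∈ R.thetaCocycles)
    (i : (𝔉.frdBiThetaEnv h1 h3 hsec hcs h8 DK).Iso (R.toThetaEnvData.modelBi hη))
    (hi : ∀ x : 𝔉.EPiN, ((CycEnvelope.proj R.augY R.chi (i.e x) : R.PiY) : R.PiX) = ι (𝔉.toPiY x))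
    (hYdd : 𝔉.PiYdd.map ι.toMonoidHom = R.PiYdd) (P : ThetaSubquotientProj 𝔉) (ψ : 𝔉.lDeltaModN 𝔉.BN ≃* R.mu)
    (hpre : ∀ k : 𝔉.PiYdd, ι (k : 𝔉.PiX) ∈ R.lDeltaTheta → 𝔉.ρ (k : 𝔉.PiX) ∈ P.pre (𝔉.base.obj 𝔉.BN))
    (hlift : ∀ a ∈ 𝔉.HB, a ∈ P.pre (𝔉.base.obj 𝔉.BN) →
      ∃ k : 𝔉.PiYdd, ι (k : 𝔉.PiX) ∈ R.lDeltaTheta ∧ 𝔉.ρ (k : 𝔉.PiX) = a)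
    (hP : ∀ (k : 𝔉.PiYdd) (hk : ι (k : 𝔉.PiX) ∈ R.lDeltaTheta) (hm : 𝔉.ρ (k : 𝔉.PiX) ∈ P.pre (𝔉.base.obj 𝔉.BN)),
      (QuotientGroup.mk (P.proj _ ⟨𝔉.ρ (k : 𝔉.PiX), hm⟩) : 𝔉.lDeltaModN 𝔉.BN) =
        ψ.symm (R.thetaMod ⟨ι (k : 𝔉.PiX), hk⟩))
    (ρf : RigidityFamily 𝔉) (hB : 𝔉.IsThetaSaturated 𝔉.BN) :
    IsKummerDetermined 𝔉 P ρf hB ↔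
      𝔉.CycRigidityCoincide (𝔉.rho219OfBiTheta h1 h3 hsec hcs h8 DK R.toThetaEnvData ι hη i hi ψ) ρf hB :=
  ⟨fun hρf => 𝔉.cycRigidityCoincide_rho219OfBiTheta_of_rowTwo h1 h3 hsec hcs h8 DK R ι hη i hi hYdd P ρf hB hρf ψ hpre
      hlift hP,
    fun hρf => 𝔉.isKummerDetermined_of_eq_rho219OfBiTheta h1 h3 hsec hcs h8 DK R ι hη i hi hYdd P ψ hlift hP ρf hB hρf⟩

end ThetaFrobenioid

end Literature.AnabelianGeometry.EtaleTheta

end
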